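import Summits.HodgeConjecture.HodgeConjecture.Theorems.R90S4OneDimBaseChange      -- ★ (S4#C-1D, p861888) `oneDimG`, `oneDimGt`, `bcChar`, `isOpen_ker_comp_det`
import Summits.HodgeConjecture.HodgeConjecture.Theorems.R90S4SplitFormGL           -- ★ `splitFormGL L : GL (Fin 3) L`, `↑(splitFormGL L) = splitForm L 3` (rfl)
import Literature.NumberTheory.Rogawski1990.XiLocalCharacter                        -- ★ `UnitaryGroup.localDet`, `continuous_localDet`, `coe_localDet`
import HarnessLib

/-!
# R90-TF · S4 (Ch. 13.1–2) · hand p04 — S4#C-KER: the one-dimensional class `⟦ℂ_{ψ ∘ det}⟧` of `G_v = U(Φ₃)(L⁺_v)` — the LEFT member of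
# Prop. 13.2.2 (b) «`ψ_G(ψ ∘ det) = ψ̃ ∘ det`», typed at the kit of record (`GLoc L v`, `Φ₃ = splitForm L 3 = ↑(splitFormGL L)`)

Cell `hodgecm-mathlib`, crux H413 (`stmt-HodgeConjecture-24833`), route of record `HCCMUnconditional`; programme R90-TF (brief
`director/R90-BRIEF.v2.md` 1f40d54518340a35), section S4 = Rogawski Ch. 13.1–2 (base `R90-C131`), seat R90-C131-p04 (g0), hand S4#C-KER (S4 dealer K2E2-plan (g6),
R90 bus 2026-09-04T16:34:04Z (4)).  Lane `--supports stmt-HodgeConjecture-24833 --as helper`; ★-only imports (three ★ `Theorems` + ★ `Literature`); THEOREMS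
ONLY — no definition (the dealer's «`detCharG`-free version»: the character is the bare composite `ψ.comp (localDet …)`), no instance, no notation, no `sorry`.

PRINT.  [Rogawski1990, Prop. 13.2.2 (b) p. 201]: «`ψ_G(ψ ∘ det) = ψ̃ ∘ det` where `ψ̃(x) = ψ(x∕x̄)`», `ψ` a character of `E¹ = U(1)`; [§12.2 p. 174]: the one-dimensional
representations of `G = U(3)` are the `ψ ∘ det`, `det : G → E¹`; [§3.13]: `det` of a unitary matrix has norm one.

CONTENTS (all at `G_v := (cmDatum L 3 (splitForm L 3)).Local v` = file A's `GLoc L v`, and `E¹_v := ↥(normOneUnits (conjLocal L c v))`, `c` = complex conjugation):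
* §1 `ψ ∘ det`: the composite `ψ.comp (UnitaryGroup.localDet c v (isUnit_antidiagOne_det L 3)) : G_v →* ℂˣ` TYPE-CHECKS at `GLoc L v` with no cast — ★ `localDet` is
  stated on `↥(«local» L c 3 (Matrix.of …) v)`, and `(cmDatum L 3 (splitForm L 3)).Local v` unfolds to exactly that carrier (★ `cmDatum_Local` `rfl`, ★ `splitForm`
  an `abbrev` of the same `Matrix.of`); recorded as `detCharG_eq` (`rfl`, the bridge BY NAME).  `detChar_apply_coe` — its value at `g` is `ψ ⟨det g, _⟩`;
  `isOpen_ker_detChar` — `ker (ψ ∘ det)` is open when `ker ψ` is (★ `continuous_localDet`); `isAdmissible_mk_ofChar_detChar`.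
* §2 the bridge to ★ `oneDimG` at `Φ := splitFormGL L` (★ `R90S4SplitFormGL`: `↑(splitFormGL L) = splitForm L 3` reducibly): `oneDimG L v (splitFormGL L) (ψ.comp (localDet …))
  (isOpen_ker_detChar …)` is WELL-TYPED and equals `IrrClass.mk (SmoothIrrep.ofChar _ _)` on `GLoc L v` (`oneDimG_splitFormGL_detChar_eq`, `rfl`) — the left member of
  the Lines-C socket 13.2.2 (b₂); and `mk_ofChar_detChar_eq_iff` — two such classes coincide iff the characters `ψ, ψ′` agree on the image of `det`
  (in particular `ψ = ψ′` suffices; ★ `IrrClass.mk_ofChar_eq_mk_ofChar_iff`).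

HONEST LABEL: HC_CM is proved only modulo the 7 printed citations (2 remaining named inputs: hLiu418 = stmt-HodgeConjecture-24832, h413 =
stmt-HodgeConjecture-24833) until rung 0 closes; this file is typing hygiene for S4 FILE C and discharges no citation.  REL ≠ ★ ≠ BUILT.

## References
* [Rogawski1990] J. D. Rogawski, *Automorphic Representations of Unitary Groups in Three Variables*, Ann. of Math. Stud. 123 (1990), §13.2 Prop. 13.2.2 (b) p. 201;
  §12.2 p. 174; §3.13.
* [BushnellHenniart2006] C. J. Bushnell, G. Henniart, *The Local Langlands Conjecture for GL(2)*, Grundlehren 335 (2006), §1.5.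
-/

set_option autoImplicit false
set_option linter.dupNamespace false

noncomputable section

open NumberField IsDedekindDomain
open scoped Matrix MatrixGroups
open Literature.NumberTheory.Automorphic Literature.NumberTheory.Automorphic.UnitaryGroup
open Summit.HodgeConjecture.HodgeConjecture.Cruxes.H413.F0P3InnerFormClassificationV6 (splitForm)

namespace Summit.HodgeConjecture.HodgeConjecture.R90.S4

variable (L : Type) [Field L] [NumberField L] [IsCMField L] (v : HeightOneSpectrum (𝓞 ↥(maximalRealSubfield L)))

/-! ## §1 `ψ ∘ det : G_v →* ℂˣ` at the carrier of record -/

/-- **THE BRIDGE BY NAME (`rfl`)**: ★ `localDet c v (isUnit_antidiagOne_det L 3)`, stated on `↥(«local» L c 3 (Matrix.of fun i j => if i+j+1 = 3 then 1 else 0) v)`,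
IS a homomorphism out of `G_v = (cmDatum L 3 (splitForm L 3)).Local v` (file A's `GLoc L v`): the two carriers are the same type by unfolding (★ `cmDatum_Local`,
★ `splitForm`), so `ψ.comp (localDet …)` elaborates at `GLoc L v` with no cast. [cite: Rogawski1990, §12.2 p. 174; §3.13] -/
theorem detCharG_eq (ψ : ↥(normOneUnits (conjLocal L (IsCMField.complexConj L) v)) →* ℂˣ) :
    (ψ.comp (localDet (IsCMField.complexConj L) v (isUnit_antidiagOne_det L 3)) :
        (cmDatum L 3 (splitForm L 3)).Local v →* ℂˣ) =
      ψ.comp (localDet (IsCMField.complexConj L) v (isUnit_antidiagOne_det L 3)) := rfl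

/-- `(ψ ∘ det) g = ψ(det g)`, the unit `det g ∈ E¹_v` read through ★ `coe_localDet`. [cite: Rogawski1990, §12.2 p. 174] -/
theorem detChar_apply (ψ : ↥(normOneUnits (conjLocal L (IsCMField.complexConj L) v)) →* ℂˣ) (g : (cmDatum L 3 (splitForm L 3)).Local v) :
    (ψ.comp (localDet (IsCMField.complexConj L) v (isUnit_antidiagOne_det L 3))) g =
      ψ (localDet (IsCMField.complexConj L) v (isUnit_antidiagOne_det L 3) g) := rfl

/-- The unit underlying `det g ∈ E¹_v` is `Matrix.GeneralLinearGroup.det g` (★ `coe_localDet`). [cite: Rogawski1990, §3.13] -/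
theorem coe_localDet_splitForm (g : (cmDatum L 3 (splitForm L 3)).Local v) :
    ((localDet (IsCMField.complexConj L) v (isUnit_antidiagOne_det L 3) g : ↥(normOneUnits (conjLocal L (IsCMField.complexConj L) v))) :
        (LocalRing L v)ˣ) =
      Matrix.GeneralLinearGroup.det (g.val : GL (Fin 3) (LocalRing L v)) := rfl

/-- **`ker (ψ ∘ det)` is open when `ker ψ` is** (★ `continuous_localDet`): `ψ ∘ det` is a SMOOTH character of `G_v`. [cite: BushnellHenniart2006, §1.5] -/
theorem isOpen_ker_detChar (ψ : ↥(normOneUnits (conjLocal L (IsCMField.complexConj L) v)) →* ℂˣ)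
    (hψ : IsOpen ((ψ.ker : Subgroup ↥(normOneUnits (conjLocal L (IsCMField.complexConj L) v))) :
      Set ↥(normOneUnits (conjLocal L (IsCMField.complexConj L) v)))) :
    IsOpen (((ψ.comp (localDet (IsCMField.complexConj L) v (isUnit_antidiagOne_det L 3)) :
        (cmDatum L 3 (splitForm L 3)).Local v →* ℂˣ).ker : Set ((cmDatum L 3 (splitForm L 3)).Local v))) := by
  rw [← MonoidHom.comap_ker, Subgroup.coe_comap]
  exact hψ.preimage (continuous_localDet (IsCMField.complexConj L) v (isUnit_antidiagOne_det L 3))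

/-- The class `⟦ℂ_{ψ ∘ det}⟧ ∈ Irr(G_v)` is admissible (★ `isAdmissible_trivial_twist`). [cite: BushnellHenniart2006, §1.5] -/
theorem isAdmissible_mk_ofChar_detChar (ψ : ↥(normOneUnits (conjLocal L (IsCMField.complexConj L) v)) →* ℂˣ)
    (hψ : IsOpen ((ψ.ker : Subgroup ↥(normOneUnits (conjLocal L (IsCMField.complexConj L) v))) :
      Set ↥(normOneUnits (conjLocal L (IsCMField.complexConj L) v)))) :
    (IrrClass.mk (SmoothIrrep.ofChar (ψ.comp (localDet (IsCMField.complexConj L) v (isUnit_antidiagOne_det L 3)) :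
        (cmDatum L 3 (splitForm L 3)).Local v →* ℂˣ) (isOpen_ker_detChar L v ψ hψ))).IsAdmissible :=
  (IrrClass.isAdmissible_mk _).2 (isAdmissible_trivial_twist (isOpen_ker_detChar L v ψ hψ))

/-! ## §2 The bridge to ★ `oneDimG` at `Φ := splitFormGL L` -/

/-- **`⟦ℂ_{ψ ∘ det}⟧` as ★ `oneDimG L v (splitFormGL L) …` is WELL-TYPED at `GLoc L v`** (`↑(splitFormGL L) = splitForm L 3` reducibly, ★ `coe_splitFormGL`) and IS
`IrrClass.mk (SmoothIrrep.ofChar (ψ ∘ det) _)` (`rfl`) — the left member `ψ ∘ det ∈ Π(G_v)` of Prop. 13.2.2 (b) for the Lines-C socket.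
[cite: Rogawski1990, §13.2 Prop. 13.2.2 (b) p. 201] -/
theorem oneDimG_splitFormGL_detChar_eq (ψ : ↥(normOneUnits (conjLocal L (IsCMField.complexConj L) v)) →* ℂˣ)
    (hψ : IsOpen ((ψ.ker : Subgroup ↥(normOneUnits (conjLocal L (IsCMField.complexConj L) v))) :
      Set ↥(normOneUnits (conjLocal L (IsCMField.complexConj L) v)))) :
    oneDimG L v (splitFormGL L) (ψ.comp (localDet (IsCMField.complexConj L) v (isUnit_antidiagOne_det L 3)) :
        (cmDatum L 3 (splitForm L 3)).Local v →* ℂˣ) (isOpen_ker_detChar L v ψ hψ) =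
      (IrrClass.mk (SmoothIrrep.ofChar (ψ.comp (localDet (IsCMField.complexConj L) v (isUnit_antidiagOne_det L 3)) :
          (cmDatum L 3 (splitForm L 3)).Local v →* ℂˣ) (isOpen_ker_detChar L v ψ hψ)) :
        IrrClass ((cmDatum L 3 (splitForm L 3)).Local v)) := rfl

/-- **`⟦ℂ_{ψ ∘ det}⟧ = ⟦ℂ_{ψ′ ∘ det}⟧` iff `ψ ∘ det = ψ′ ∘ det`** (★ `IrrClass.mk_ofChar_eq_mk_ofChar_iff`); in particular equal characters give equal classes.
[cite: BushnellHenniart2006, §1.1, §1.5] -/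
theorem oneDimG_splitFormGL_detChar_eq_iff (ψ ψ' : ↥(normOneUnits (conjLocal L (IsCMField.complexConj L) v)) →* ℂˣ)
    (hψ : IsOpen ((ψ.ker : Subgroup ↥(normOneUnits (conjLocal L (IsCMField.complexConj L) v))) :
      Set ↥(normOneUnits (conjLocal L (IsCMField.complexConj L) v))))
    (hψ' : IsOpen ((ψ'.ker : Subgroup ↥(normOneUnits (conjLocal L (IsCMField.complexConj L) v))) :
      Set ↥(normOneUnits (conjLocal L (IsCMField.complexConj L) v)))) :
    oneDimG L v (splitFormGL L) (ψ.comp (localDet (IsCMField.complexConj L) v (isUnit_antidiagOne_det L 3)) :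
          (cmDatum L 3 (splitForm L 3)).Local v →* ℂˣ) (isOpen_ker_detChar L v ψ hψ) =
        oneDimG L v (splitFormGL L) (ψ'.comp (localDet (IsCMField.complexConj L) v (isUnit_antidiagOne_det L 3)) :
          (cmDatum L 3 (splitForm L 3)).Local v →* ℂˣ) (isOpen_ker_detChar L v ψ' hψ') ↔
      (ψ.comp (localDet (IsCMField.complexConj L) v (isUnit_antidiagOne_det L 3)) : (cmDatum L 3 (splitForm L 3)).Local v →* ℂˣ) =
        ψ'.comp (localDet (IsCMField.complexConj L) v (isUnit_antidiagOne_det L 3)) :=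
  IrrClass.mk_ofChar_eq_mk_ofChar_iff _ _

/-- **The pair of Prop. 13.2.2 (b) is well-typed at the kit of record**: the left member `⟦ℂ_{ψ∘det}⟧ ∈ Irr(G_v)` (this file) and the right member
`⟦ℂ_{ψ̃∘det}⟧ ∈ E_ε(G̃_v)` (★ `isEpsClassAt_oneDimGt_bcChar_det`, p861888) are built from THE SAME `ψ : E¹_v →* ℂˣ` with open kernel; here the right member's
`E_ε`-membership at `Φ := splitFormGL L`, given the hermitian identity `hΦ` for `splitFormGL L` (S4#C-HERM). [cite: Rogawski1990, §13.2 Prop. 13.2.2 (b) p. 201] -/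
theorem isEpsClassAt_splitFormGL_oneDimGt_bcChar_det
    (hΦ : ((splitFormGL L : GL (Fin 3) L) : Matrix (Fin 3) (Fin 3) L)ᵀ.map (IsCMField.complexConj L) = (splitFormGL L : Matrix (Fin 3) (Fin 3) L))
    (ψ : ↥(normOneUnits (conjLocal L (IsCMField.complexConj L) v)) →* ℂˣ)
    (hψ : IsOpen ((ψ.ker : Subgroup ↥(normOneUnits (conjLocal L (IsCMField.complexConj L) v))) :
      Set ↥(normOneUnits (conjLocal L (IsCMField.complexConj L) v)))) :
    IsEpsClassAt L (splitFormGL L) v (oneDimGt L v ((bcChar L v ψ).comp Matrix.GeneralLinearGroup.det)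
      (isOpen_ker_comp_det L v (bcChar L v ψ) (isOpen_ker_bcChar L v ψ hψ))) :=
  isEpsClassAt_oneDimGt_bcChar_det L v (splitFormGL L) hΦ ψ hψ

end Summit.HodgeConjecture.HodgeConjecture.R90.S4

end
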